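import Literature.Claims.NS.Permana2026
import Literature.Analysis.FluidPDE.VorticityEnstrophyGronwallForced
import HarnessLib

/-!
# C160 `Qin2026` — QIN Zitai (秦子泰), «The Unconditional Proof of Finite-Time Blowup for the
# Three-Dimensional Incompressible Navier–Stokes Equations — Based on Tightly Interlocked Multi-Vortex
# Rings and Weighted Energy Blowup» (Zenodo 21857936, 9 August 2026, 50 pp.)

Claim skeleton of the D-0090 «where NS proofs break» map (cell `ns-claims`), typist of record
ns-claims-typist-12 g5 (QUICK skeleton: the printed chain at the grain it is printed in; the §6–§7
weighted quantities are not typed — see the step table). Text of record = census pin `census/texts/Qin2026/`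
(PDF sha16 fd8fb64d2ed7754c; PDF page = printed page = `pages/pNNN.txt`; `l.N` = text-layer line; LOCATORS
`sources/Qin2026/LOCATORS.md`, lit-2 g6). Direction: BREAKDOWN (NEG) on `ℝ³`, unforced, ONE explicit datum
family (three «Hopf-linked» Gaussian-core vortex rings), with a circulation/viscosity threshold.

## The printed statements (verbatim)

* **Theorem 1.1 (Finite-Time Singularity)** (p.8 l.21–40; = Thm 11.1 p.31 l.30–49): «There exists a smooth
  divergence-free initial datum u₀ ∈ C^∞(ℝ³) ∩ L²(ℝ³) ∩ H¹(ℝ³) satisfying ∇·u₀ = 0 and the far-field power-law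
  decay |u₀(x)| ≲ 1/|x|², together with an explicit time constant T* < ∞ depending only on the initial datum,
  such that the corresponding strong solution u of (1) blows up at T*: lim sup_{t→(T*)⁻} ‖∇u(t)‖_{L∞} = ∞ (2)».
* **Theorem 1.2 (Answer to the Millennium Problem)** (p.8 l.41–43; = Thm 11.2 p.32): «The three-dimensional
  incompressible Navier–Stokes equations do not admit global smooth solutions for all smooth initial
  data—option (B) holds.» with the paper's options p.8 l.13–18: «(A) For every smooth initial datum
  u₀ ∈ C^∞(ℝ³) satisfying ∇·u₀ = 0 and suitable decay conditions, there exists a global smooth solution. (B)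
  There exists some smooth initial datum for which the corresponding smooth solution blows up (loses
  regularity) in finite time.»; Thm 11.2's proof p.32: «Theorem 11.1 … constitutes a counterexample to the
  universal global regularity statement (Option A). Hence Option (B) is true.»
* **Construction 3.1, (13)** (p.12 l.32–41): «γ₁(θ) = (R cos θ, R sin θ, d₀), γ₂(θ) = (d₀, R cos θ, R sin θ),
  γ₃(θ) = (R sin θ, d₀, R cos θ), θ ∈ [0,2π] … where d₀ = αρ₀ is the offset parameter. For sufficiently large
  R and appropriate d₀ (with α = 16), the three circles are pairwise disjoint …».
* **Lemma 3.1 (Disjointness and Linking Number)** (p.12 l.42–59): «With d₀ = αρ₀, R = 10⁴ρ₀, and α = 16: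
  (i) The distance between any two circles is at least d̄ = αρ₀ > 0; (ii) The linking number between any two
  circles is lk = +1, and the Gauss linking integral equals exactly 4π².» Proof (i): «|γ₁(θ) − γ₂(ϕ)|² =
  (R cos θ − d₀)² + (R sin θ − R cos ϕ)² + (d₀ − R sin ϕ)². Minimizing over θ, ϕ by calculus and algebraic
  methods yields a strictly positive lower bound when d₀ = αρ₀ with α ≥ 8 and R ≫ ρ₀.»
* **Construction 3.2 (14)** (p.12 l.61–74) line-vortex Biot–Savart field; **Def 3.2 (15)** (p.13) Gaussian-core
  pre-vorticity «ω̃ₖ(x) := Γ₀/(2πρ₀²)^{3/2} ∫₀^{2π} exp(−|x − γₖ(s)|²/(2ρ₀²)) γ̇ₖ(s) ds/(2π)»; **Def 3.4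
  (16)–(18)** Helmholtz correction «ρₖ := ∇·ω̃ₖ», «ψₖ = G ∗ ρₖ, G(x) = −1/(4π|x|)», «ωₖ := ω̃ₖ − ∇ψₖ», «The
  total vorticity field is ω = Σₖ ωₖ, and the velocity field u₀ is recovered from ω via the Biot–Savart law
  (7)» («u(x) = (1/4π)∫ ω(y) × (x − y)/|x − y|³ dy», p.11); **Def 3.7** (p.14 l.2–11) parameters N = 3,
  R = 10⁴ρ₀, L₀ = 2πR, d̄ = d₀ = 16ρ₀, ρ₀ free, Γ₀ free «(must satisfy Γ₀/ν > 2.27 × 10⁴)»; **Lemma 3.8 (20)**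
  «E₀ = C_E NΓ₀²L₀/ρ₀², C_E = 1/(8π)»; (5) p.10: «E(t) := ½∫|ω(x,t)|² dx», (33) p.18: «S := ∫ ω·S·ω dx».
* **Theorem 5.4 (36)** (p.19–20): «S_ij ≥ (C_geom Γ₀³L₀²/(ρ₀²d̄_ij³))[1 − C_err^{(2)}/α² − O(ρ₀/R)]»;
  **Theorem 5.8 (41)–(42)** (p.21 l.6–23): «On the effective interval [0,T*] of Theorem 7.9 (Section 7), the
  stretching term is controlled from below by a quadratic function of the enstrophy: S(t) ≥ (C_lower/(Γ₀L₀))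
  E(t)² (41) with C_lower = 8π(N−1)/(Nα³) · R/ρ₀ (42). For N = 3, α = 16, R/ρ₀ = 10⁴: C_lower ≈ 40.9.»; its
  proof Step 2 (p.21): «From the initial enstrophy scale (20), ρ₀² = C_E NΓ₀²L₀/E₀. On the blowup window,
  E(t) ≤ 2E₀, hence ρ₀² ≥ C_E NΓ₀²L₀/(2E(t)). Substituting into the denominator ρ₀²d̄³ = α³ρ₀⁵:
  Γ₀³L₀²/ρ₀⁵ = Γ₀³L₀²/(ρ₀·ρ₀⁴) ≥ (Γ₀³L₀²/ρ₀) · E(t)²/(C_E²N²Γ₀⁴L₀²) = E(t)²/(C_E²N²Γ₀ρ₀)».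
* **Lemma 6.2 (44)**, **Thm 6.4 (47)** «D_η ≤ C_upper ν E_η²/(Γ₀²L₀), C_upper = 32/j²₀,₁ ≈ 5.534», **Lemma 7.6
  (51)**, **Lemma 7.8 (53)**, **Thm 7.9 (54)** with the window «T*_η := sup{T ≥ 0 : E_η(t) ≤ 2E_η(0), ∀t ≤ T}»
  (p.26 l.87–90); **(55)** p.27 «dE_η/dt ≥ [C_lower − C_upper ν/Γ₀ − C″_η(ν+Γ₀)/Γ₀] E_η²/(Γ₀L₀)»; **Thm 8.1
  (56)–(57)** «If Γ₀/ν > (C_upper + C″_η)/(C_lower − C″_η) then there exists a strictly positive constant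
  C_blow > 0 such that dE_η/dt ≥ C_blow E_η²»; **Cor 8.2 (58)–(59)** (p.28 l.2–26) «E_η(t) ≥ 1/(E_η(0)⁻¹ −
  C_blow t) (58) The denominator vanishes as t → 1/(C_blow E_η(0)). Hence T* ≤ 1/(C_blow E_η(0)) < ∞ (59) The
  weighted enstrophy—and consequently the original enstrophy E(t) ≥ E_η(t)—blows up in finite time.»; **Thm
  9.1 (60)** enstrophy blow-up ⇒ velocity-gradient blow-up; **Thm 10.3 (64)–(65)** threshold «Γ₀/ν >
  C_threshold ≈ 2.27 × 10⁴».

## How it is typed (QUICK)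

Parameters as printed (`alpha = 16`, `Rof ρ₀ = 10⁴ρ₀`, `d0 ρ₀ = 16ρ₀`, `L0`, `CE`, `Cgeom`, `Clower` (42) in
closed form, `Ceta = 64/α`, `Cupper` and `Cthr` as the printed decimals — `j₀,₁` has no Mathlib name). The
centerlines (13) are explicit (`gam1 gam2 gam3`), their velocities too; the DATUM is typed in full as printed:
(15) `preVort`, (16) `preVortDiv`, (17) `psi` (Newton potential), (18) `vortK`, `vortTotal`, and `u0` = the
Biot–Savart field (7) of `vortTotal` ((14), the LINE-vortex field, is typed too as `u0Line` but is not the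
`C^∞ ∩ H¹` datum of Thm 1.1 — recorded). `IsPrintedDatum` = the data class printed in Thm 1.1 (smooth,
divergence-free, `L²`, `∇u₀ ∈ L²`, far-field `|u₀| ≤ C/|x|²`). «The corresponding strong solution» = the
BKM-class local solution of C17/C119 (`Chae2007.IsLocalSolution ν T u₀ u p`: classical on `[0,T)`, all `L²`
Sobolev norms bounded on compact sub-slabs); «lim sup_{t→T*⁻}‖∇u‖_{L∞} = ∞» = `GradBlowsUpAt T* u` (the
velocity gradient is not bounded on `[0,T*) × ℝ³`). `ClaimedTheorem` = Thm 1.1 (for every `ν > 0` a datum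
of the printed class and an explicit `T*`); `Thm12` = the paper's «option (B) holds» read as the failure of
its Option (A) with «suitable decay conditions» = Clay's (4) (`ClayVariants.clayR3.RegularityAt`), so that
`clayC_of_thm12 : Thm12 → clayR3.Breakdown` is PROVED (tree `ClaySpec.breakdown_of_not_regularityAt`); the
printed one-line inference Thm 11.1 ⇒ Thm 11.2 is the typed step `Step112 : ClaimedTheorem → Thm12` — NOT
provable as typed: the Thm 1.1 datum class (power-law decay) is not Clay's (4) — **Δ4, the Clay delta of
this row, sits exactly in `Step112`** (no `clay_of_claimed` from `ClaimedTheorem` alone).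

## Step table (dependency order = the «Proof Summary» p.31–32 / §1.3)

| Step | decl | print | typed content | typist's note |
|---|---|---|---|---|
| 3.1(i) | **`Step31_i`** | Lemma 3.1 (i) p.12 l.42–52 | pairwise distance of the circles (13) ≥ d̄ = 16ρ₀ at R = 10⁴ρ₀, d₀ = 16ρ₀ | SUSPICIOUS: the point (d₀, R√(1−(d₀/R)²), d₀) lies on γ₁ AND γ₂ (LOCATORS §3, lit-2 g6) — kernel-decidable real arithmetic; d̄ enters (36)/(41) as d̄⁻³ and §7.1's «disjoint tubes» |
| 3.1(i)′ | `Step31_i_asProved` | proof of (i) p.12 l.49–52 | «strictly positive lower bound when d₀ = αρ₀ with α ≥ 8 and R ≫ ρ₀» | same status |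
| 3.1(ii) | `Step31_ii` | Lemma 3.1 (ii) p.12 | Gauss double integral of (γ₁,γ₂) = 4π² | recorded as printed (for a genuine link the Gauss integral is 4π·lk); not a handle |
| 3.1c | `Step31_charitable` | p.12 l.26–31, p.31 l.51–53 | ∃ three round circles radius R, pairwise distance ≥ d̄, pairwise |Gauss link| = 1 (no formula) | the CHARITABLE face (REF-4 (a)); TRUE in substance |
| 3 | `Step3_datum` | Constr. 3.2–3.4, Thm 1.1 data clause | `u0 Γ₀ ρ₀` is in the printed class | TRUE-type in substance (Gaussian-core Biot–Savart field: smooth, div-free, |x|⁻³ far field) — not discharged |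
| 5.4 | (recorded) | (36) p.19–20 | per-pair cross stretching | needs the Fermi-coordinate apparatus; not typed (QUICK) |
| 5.8 | `Step58` | (41)–(42) p.21 | along every class solution from `u0 Γ₀ ρ₀`, on the window `E ≤ 2E₀`: `S(t) ≥ (C_lower/(Γ₀L₀))E(t)²` | a-priori law for one flow; not a kernel handle by instantiation |
| 5.8/2 | **`Step58_2`** | proof Step 2 p.21 | real grain: `ρ₀² = C_E NΓ₀²L₀/E₀ ∧ E ≤ 2E₀ ⇒ Γ₀³L₀²/ρ₀⁵ ≥ (Γ₀³L₀²/ρ₀)·E²/(C_E²N²Γ₀⁴L₀²)` | SUSPICIOUS (direction: from ρ₀² ≥ … one gets an UPPER bound; false whenever E₀ < E ≤ 2E₀) |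
| 6–7 | (recorded) | (44) (47) (51) (53) | weighted dissipation/remainder bounds | not typed (weights η_ε around material centerlines); LOCATORS §3 circularity map; Lemma 7.6 (b) «‖ω‖_{H²} bounded on the window» recorded |
| 7.9 | **`Step79`** / `Step79_withLower` | Thm 7.9 (54) p.26–27 | real grain with the proof's DECLARED inputs ((50), (51), window) / with the undeclared `E_η ≥ E_η(0)/2` its upper-bound line uses | SUSPICIOUS as declared (upper bound fails for small E_η) / TRUE |
| 8.2 | `Step82_58` | Cor 8.2 (58) p.28 | ODE grain: `y′ ≥ Cy²` on `[0,T)` ⇒ `y(t) ≥ 1/(y₀⁻¹ − Ct)` while `Ct < y₀⁻¹` | TRUE (comparison) — dischargeable |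
| 8.2′ | **`Step82_59`** | Cor 8.2 (59) + l.25–26 | real-function grain: (57) holding on the WINDOW `{E_η ≤ 2E_η(0)}` (where Thm 8.1 has it) ⇒ blow-up by `1/(C_blow E_η(0))` | SUSPICIOUS (a function capped at 2y₀ after the window obeys the hypothesis and is bounded) |
| 8 | `Step8_out` | Thm 8.1 + Cor 8.2 as USED (p.28 l.25–26), with Thm 10.3's threshold | along every class solution from `u0 Γ₀ ρ₀` with `Γ₀/ν > C_thr`: ∃ T* (datum-only) with the enstrophy unbounded on `[0,T*)` | (C)-strength a-priori for one datum; the printed route to it = `Step8_inference` |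
| 8″ | `Step8_inference` | §§3–8 | `Step31_i → Step58 → Step82_59 → Step8_out` | the printed inference (its untyped links (36), (47), (53) recorded) |
| 9.1 | `Step91` | Thm 9.1 (60) p.28–29 | class solution with unbounded enstrophy on `[0,T′)` has unbounded gradient there | TRUE-type (H¹ Grönwall by sup‖∇u‖) |
| 11.2 | **`Step112`** | Thm 11.2 proof p.32 | `ClaimedTheorem → Thm12` | Δ4 (data class) — not provable as typed |

Compositions PROVED (pure logic): `claim_of_steps : Step3_datum → Step8_out → Step91 → ClaimedTheorem`;
`claim_of_steps_full : Step31_i → Step58 → Step82_59 → Step8_inference → Step3_datum → Step91 → ClaimedTheorem`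
(Lemma 3.1 (i) on path as binder `h31`); `clayC_of_steps : … → Step112 → clayR3.Breakdown`.

## Kernel handles (typist's reading, no assertion; grain/order are the refuter's)

(a) `Step31_i` at ρ₀ = 1: θ = arccos c, ϕ = arcsin c with c = 16/10⁴ give γ₁ θ = γ₂ ϕ = (16, 10⁴√(1−c²), 16)
(`Real.cos_arccos`, `Real.sin_arccos`, `Real.sin_arcsin`, `Real.cos_arcsin`; `dist_self`/`EuclideanSpace.dist_eq`),
so `dist = 0 < 16`. (b) `Step58_2`: C_E = N = Γ₀ = L₀ = 1, E₀ = 1, ρ₀ = 1, E = 2: hypothesis `1 = 1`, `2 ≤ 2`;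
claim `1 ≥ 4` false. (c) `Step82_59`: y₀ = C = 1, y(t) = 1/(1−t) on [0,½] and y ≡ 2 after: window = [0,½],
(57) holds there, y bounded by 2. (d) `Step3_datum`, `Step58`, `Step8_out`, `Step91` are statements about the
specific Biot–Savart datum/flow — (d) not handles by instantiation.

## References

* [Qin2026] Qin Zitai, Zenodo 21857936 (2026).
* [FeffermanClay2006] C. L. Fefferman, CMI 2006, (A)–(D) with (4) (5) (7) p. 2.

WHAT THIS IS NOT: not a claim about NS regularity or blow-up; not a claim about any author beyond the typed
locator.
-/

noncomputable section

open Set MeasureTheory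
open scoped ContDiff ENNReal NNReal Topology

namespace Literature.Claims.NS.Qin2026

open Literature.Analysis.FluidPDE Literature.Claims.NS.ClayVariants
open Literature.Claims.NS.Chae2007 (IsLocalSolution)
open Literature.Claims.NS.Permana2026 (enstrophy stretch)

/-- `ℝ³`. [cite: Qin2026, (1) p.8] -/
abbrev E3 : Type := EuclideanSpace ℝ (Fin 3)

/-! ## Parameters and constants (Def 3.7 p.14; table p.7) -/

/-- `α = 16` (Def 3.7 p.14 l.10–11). [cite: Qin2026, Def 3.7 p.14 l.2–11] -/
def alpha : ℝ := 16

/-- `R = 10⁴ρ₀` (Def 3.7). [cite: Qin2026, Def 3.7 p.14 l.6] -/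
def Rof (ρ₀ : ℝ) : ℝ := 10 ^ 4 * ρ₀

/-- `d₀ = d̄ = αρ₀ = 16ρ₀` (Def 3.7; (13)). [cite: Qin2026, Def 3.7 p.14 l.9–11] -/
def d0 (ρ₀ : ℝ) : ℝ := alpha * ρ₀

/-- `L₀ = 2πR` (Def 3.7). [cite: Qin2026, Def 3.7 p.14 l.7] -/
def L0 (ρ₀ : ℝ) : ℝ := 2 * Real.pi * Rof ρ₀

/-- `C_E = 1/(8π)` ((20) p.14). [cite: Qin2026, Lemma 3.8 (20) p.14] -/
def CE : ℝ := 1 / (8 * Real.pi)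

/-- `C_geom = 1/(32π²)` ((37) p.20; abstract p.2). [cite: Qin2026, Thm 5.4 (37) p.20] -/
def Cgeom : ℝ := 1 / (32 * Real.pi ^ 2)

/-- `C_lower = 8π(N−1)/(Nα³) · R/ρ₀` with `N = 3`, `R/ρ₀ = 10⁴` ((42) p.21; «≈ 40.9»). [cite: Qin2026, Thm 5.8 (42) p.21 l.14–23] -/
def Clower : ℝ := 8 * Real.pi * (3 - 1) / (3 * alpha ^ 3) * 10 ^ 4

/-- `C″_η = 64/α = 4.0` (Lemma 7.8 p.26; table p.7). [cite: Qin2026, Lemma 7.8 (53) p.26] -/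
def Ceta : ℝ := 64 / alpha

/-- `C_upper = 32/j²₀,₁ ≈ 5.534` (Thm 6.4 (47) p.23; table p.7) — the printed DECIMAL is carried (`j₀,₁`, the
first zero of `J₀`, has no Mathlib name). [cite: Qin2026, Thm 6.4 (47) p.23 l.33–36] -/
def Cupper : ℝ := 5.534

/-- `C_threshold ≈ 2.27 × 10⁴` (Def 3.7 «Γ₀ … must satisfy Γ₀/ν > 2.27 × 10⁴»; Thm 10.3 (65) p.31) — the
printed decimal. [cite: Qin2026, Def 3.7 p.14 l.4–5; Thm 10.3 (64)–(65) p.30–31] -/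
def Cthr : ℝ := 2.27 * 10 ^ 4

/-- `E₀ = C_E NΓ₀²L₀/ρ₀²`, `N = 3` ((20) p.14, «bulk enstrophy (neglecting O(ρ₀²/R²) corrections)»).
[cite: Qin2026, Lemma 3.8 (20) p.14 l.12–20] -/
def E0 (Γ₀ ρ₀ : ℝ) : ℝ := CE * 3 * Γ₀ ^ 2 * L0 ρ₀ / ρ₀ ^ 2

/-! ## The centerlines (13) and the datum (15)–(18), (7), (14) -/

/-- `γ₁(θ) = (R cos θ, R sin θ, d₀)`. [cite: Qin2026, (13) p.12 l.35] -/
def gam1 (R d : ℝ) (θ : ℝ) : E3 := !₂[R * Real.cos θ, R * Real.sin θ, d]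

/-- `γ₂(θ) = (d₀, R cos θ, R sin θ)`. [cite: Qin2026, (13) p.12 l.36] -/
def gam2 (R d : ℝ) (θ : ℝ) : E3 := !₂[d, R * Real.cos θ, R * Real.sin θ]

/-- `γ₃(θ) = (R sin θ, d₀, R cos θ)`. [cite: Qin2026, (13) p.12 l.37] -/
def gam3 (R d : ℝ) (θ : ℝ) : E3 := !₂[R * Real.sin θ, d, R * Real.cos θ]

/-- The three centerlines indexed by `k : Fin 3`. [cite: Qin2026, (13) p.12 l.32–38] -/
def gam (R d : ℝ) : Fin 3 → ℝ → E3 := ![gam1 R d, gam2 R d, gam3 R d]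

/-- `γ̇₁(θ) = (−R sin θ, R cos θ, 0)`. [cite: Qin2026, (13)–(14) p.12] -/
def dgam1 (R : ℝ) (θ : ℝ) : E3 := !₂[-(R * Real.sin θ), R * Real.cos θ, 0]

/-- `γ̇₂(θ) = (0, −R sin θ, R cos θ)`. [cite: Qin2026, (13)–(14) p.12] -/
def dgam2 (R : ℝ) (θ : ℝ) : E3 := !₂[0, -(R * Real.sin θ), R * Real.cos θ]

/-- `γ̇₃(θ) = (R cos θ, 0, −R sin θ)`. [cite: Qin2026, (13)–(14) p.12] -/
def dgam3 (R : ℝ) (θ : ℝ) : E3 := !₂[R * Real.cos θ, 0, -(R * Real.sin θ)]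

/-- The centerline velocities indexed by `k : Fin 3`. [cite: Qin2026, (14) p.12] -/
def dgam (R : ℝ) : Fin 3 → ℝ → E3 := ![dgam1 R, dgam2 R, dgam3 R]

/-- The cross product on `ℝ³` in coordinates. [folklore] -/
def cross (a b : E3) : E3 := !₂[a 1 * b 2 - a 2 * b 1, a 2 * b 0 - a 0 * b 2, a 0 * b 1 - a 1 * b 0]

/-- **(14)** the LINE-vortex Biot–Savart field «u₀(x) := Σₖ (Γ₀/4π) ∮_{γₖ} (x − γₖ(θ)) × γ̇ₖ(θ)/|x − γₖ(θ)|³ dθ»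
(Construction 3.2 p.12 l.61–74) — typed as printed; singular on `∪γₖ`, so NOT the `C^∞ ∩ H¹` datum of Thm
1.1 (recorded; the skeleton's datum is `u0` below). [cite: Qin2026, Construction 3.2 (14) p.12 l.61–74] -/
def u0Line (Γ₀ R d : ℝ) (x : E3) : E3 :=
  ∑ k : Fin 3, (Γ₀ / (4 * Real.pi)) •
    ∫ θ in (0:ℝ)..(2 * Real.pi), (‖x - gam R d k θ‖ ^ 3)⁻¹ • cross (x - gam R d k θ) (dgam R k θ)

/-- **(15)** Gaussian-core pre-vorticity of tube `k`: «ω̃ₖ(x) := Γ₀/(2πρ₀²)^{3/2} ∫₀^{2π} exp(−|x −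
γₖ(s)|²/(2ρ₀²)) γ̇ₖ(s) ds/(2π)», with `R = 10⁴ρ₀`, `d₀ = 16ρ₀`. [cite: Qin2026, Def 3.2 (15) p.13 l.10–16] -/
def preVort (Γ₀ ρ₀ : ℝ) (k : Fin 3) (x : E3) : E3 :=
  (Γ₀ / (2 * Real.pi * ρ₀ ^ 2) ^ (3 / 2 : ℝ)) •
    ∫ s in (0:ℝ)..(2 * Real.pi),
      (Real.exp (-(‖x - gam (Rof ρ₀) (d0 ρ₀) k s‖ ^ 2) / (2 * ρ₀ ^ 2)) / (2 * Real.pi)) •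
        dgam (Rof ρ₀) k s

/-- **(16)** `ρₖ := ∇·ω̃ₖ` (trace of the Jacobian). [cite: Qin2026, Def 3.4 (16) p.13] -/
def preVortDiv (Γ₀ ρ₀ : ℝ) (k : Fin 3) (x : E3) : ℝ :=
  ∑ i : Fin 3, fderiv ℝ (preVort Γ₀ ρ₀ k) x (EuclideanSpace.single i 1) i

/-- **(17)** `ψₖ = G ∗ ρₖ`, `G(x) = −1/(4π|x|)`. [cite: Qin2026, Def 3.4 (17) p.13] -/
def psi (Γ₀ ρ₀ : ℝ) (k : Fin 3) (x : E3) : ℝ :=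
  ∫ y, (-(1 / (4 * Real.pi * ‖x - y‖))) * preVortDiv Γ₀ ρ₀ k y

/-- **(18)** `ωₖ := ω̃ₖ − ∇ψₖ`. [cite: Qin2026, Def 3.4 (18) p.13] -/
def vortK (Γ₀ ρ₀ : ℝ) (k : Fin 3) (x : E3) : E3 :=
  preVort Γ₀ ρ₀ k x - gradient (psi Γ₀ ρ₀ k) x

/-- «The total vorticity field is ω = Σₖ ωₖ» (p.13 l.45). [cite: Qin2026, Def 3.4 p.13 l.45–48] -/
def vortTotal (Γ₀ ρ₀ : ℝ) (x : E3) : E3 := ∑ k : Fin 3, vortK Γ₀ ρ₀ k x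

/-- **THE DATUM** «the velocity field u₀ is recovered from ω via the Biot–Savart law (7)»:
`u₀(x) = (1/4π) ∫ ω(y) × (x − y)/|x − y|³ dy`, parameters `Γ₀ > 0`, `ρ₀ > 0` (`R = 10⁴ρ₀`, `α = 16`).
[cite: Qin2026, Def 3.4 p.13 l.45–48; Thm 2.7 (7) p.11] -/
def u0 (Γ₀ ρ₀ : ℝ) (x : E3) : E3 :=
  (1 / (4 * Real.pi)) • ∫ y, (‖x - y‖ ^ 3)⁻¹ • cross (vortTotal Γ₀ ρ₀ y) (x - y)

/-! ## Data class, solution class, blow-up currency -/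

/-- The data class PRINTED in Thm 1.1: «u₀ ∈ C^∞(ℝ³) ∩ L²(ℝ³) ∩ H¹(ℝ³) satisfying ∇·u₀ = 0 and the far-field
power-law decay |u₀(x)| ≲ 1/|x|²» — NOT Clay's rapid-decay class (4) (recorded: Δ4).
[cite: Qin2026, Thm 1.1 p.8 l.21–31] -/
def IsPrintedDatum (v : E3 → E3) : Prop :=
  ContDiff ℝ ∞ v ∧ NSWave0.IsDivFree v ∧ (∫⁻ x, ‖v x‖ₑ ^ 2) < ⊤ ∧ (∫⁻ x, ‖fderiv ℝ v x‖ₑ ^ 2) < ⊤ ∧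
    ∃ C R₁ : ℝ, 0 < R₁ ∧ ∀ x : E3, R₁ ≤ ‖x‖ → ‖v x‖ ≤ C / ‖x‖ ^ 2

/-- «lim sup_{t→(T*)⁻} ‖∇u(t)‖_{L∞} = ∞» (2), rendered: the velocity gradient is NOT bounded on `[0,T*) × ℝ³`
(for a class solution bounded on every earlier closed slab this is the printed lim sup).
[cite: Qin2026, Thm 1.1 (2) p.8 l.36–40] -/
def GradBlowsUpAt (T : ℝ) (u : ℝ → E3 → E3) : Prop :=
  ¬ ∃ A : ℝ, ∀ t ∈ Ico 0 T, ∀ x : E3, ‖fderiv ℝ (u t) x‖ ≤ A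

/-- `E(t) = ½∫|ω(x,t)|² dx` ((5) p.10) — half the C119 `enstrophy`. [cite: Qin2026, Thm 2.5 (5) p.10 l.34–36] -/
def Ens (u : ℝ → E3 → E3) (t : ℝ) : ℝ := (1 / 2) * enstrophy u t

/-! ## The claimed statement and the paper's (A)/(B) -/

/-- **Theorem 1.1 (= Thm 11.1), as printed**: for the viscosity `ν > 0` of (1) there are a datum of the
printed class and an explicit `T* > 0` depending only on the datum such that «the corresponding strong
solution … blows up at T*»: every BKM-class solution (`Chae2007.IsLocalSolution`) from that datum living on
`[0,T) ⊇ [0,T*)` has unbounded velocity gradient on `[0,T*)`. [claim: Qin2026, status: under-review]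
[cite: Qin2026, Thm 1.1 p.8 l.21–40; Thm 11.1 p.31 l.30–49] -/
def ClaimedTheorem : Prop :=
  ∀ ν : ℝ, 0 < ν → ∃ v₀ : E3 → E3, IsPrintedDatum v₀ ∧ ∃ Tstar : ℝ, 0 < Tstar ∧
    ∀ (T : ℝ) (u : ℝ → E3 → E3) (p : ℝ → E3 → ℝ), Tstar ≤ T → IsLocalSolution ν T v₀ u p →
      GradBlowsUpAt Tstar u

/-- The paper's **Option (A)** (p.8 l.13–16 «For every smooth initial datum u₀ ∈ C^∞(ℝ³) satisfying ∇·u₀ = 0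
and suitable decay conditions, there exists a global smooth solution»), read with «suitable decay conditions»
= Clay's (4) and «global smooth solution» = Clay's (6)–(7): `clayR3.RegularityAt ν`.
[cite: Qin2026, §1.1 p.8 l.13–16] [cite: FeffermanClay2006, (A) p.2] -/
def OptionA (ν : ℝ) : Prop := ClayVariants.clayR3.RegularityAt ν

/-- **Theorem 1.2 (= Thm 11.2) «option (B) holds»** = Option (A) fails, for the (arbitrary) viscosity `ν > 0`
of (1). [claim: Qin2026, status: under-review] [cite: Qin2026, Thm 1.2 p.8 l.41–43; Thm 11.2 p.32 l.27–32] -/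
def Thm12 : Prop := ∀ ν : ℝ, 0 < ν → ¬ OptionA ν

/-- **Step 11.2 — the printed inference Thm 11.1 ⇒ Thm 11.2** (p.32: «Theorem 11.1 … constitutes a
counterexample to the universal global regularity statement (Option A). Hence Option (B) is true.»), typed as
the implication. Typist's flag: **Δ4** — the Thm 1.1 datum class (`IsPrintedDatum`: power-law decay) is not
the rapid-decay class (4) of Option (A)/Clay, so this implication is NOT provable as typed; it is where the
row's Clay delta sits. [cite: Qin2026, Thm 11.2 proof p.32 l.29–32] -/
def Step112 : Prop := ClaimedTheorem → Thm12

/-- **`Thm12` implies Clay (C)** (`clayR3.Breakdown`, every `ν > 0`, witness force `f ≡ 0`): failure of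
unforced regularity at one viscosity gives breakdown at all (tree `ClaySpec.breakdown_of_not_regularityAt`).
[cite: FeffermanClay2006, (C) p.2] -/
theorem clayC_of_thm12 (h : Thm12) : ClayVariants.clayR3.Breakdown :=
  ClaySpec.breakdown_of_not_regularityAt one_pos clayR3_force_zero clayR3_data_smul
    clayR3_admissible_timeRescale (h 1 one_pos)

/-- The Clay link of the row runs THROUGH `Step112` (Δ4): `ClaimedTheorem`, the printed inference, Clay (C).
[cite: FeffermanClay2006, (C) p.2] -/
theorem clayC_of_claimed_of_step112 (h112 : Step112) (h : ClaimedTheorem) : ClayVariants.clayR3.Breakdown :=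
  clayC_of_thm12 (h112 h)

/-! ## The steps -/

/-- **Step 3.1 (i) — Lemma 3.1 (i) p.12 l.42–45 at the printed parameters** («With d₀ = αρ₀, R = 10⁴ρ₀, and
α = 16: (i) The distance between any two circles is at least d̄ = αρ₀ > 0»): every point of `γ₁` is at
distance `≥ 16ρ₀` from every point of `γ₂`, and likewise for the pairs (1,3), (2,3). Typist's flag:
SUSPICIOUS — with `c = d₀/R`, `s = √(1 − c²)` the point `(d₀, Rs, d₀)` is `γ₁(θ)` (`cos θ = c`) AND `γ₂(ϕ)`
(`sin ϕ = c`) (LOCATORS §3); `d̄` feeds (36)/(41) as `d̄⁻³` and §7.1's disjoint tubes.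
[claim: Qin2026, status: under-review] [cite: Qin2026, Lemma 3.1 (i) p.12 l.42–52] -/
def Step31_i : Prop :=
  ∀ ρ₀ : ℝ, 0 < ρ₀ → ∀ θ φ : ℝ,
    d0 ρ₀ ≤ dist (gam1 (Rof ρ₀) (d0 ρ₀) θ) (gam2 (Rof ρ₀) (d0 ρ₀) φ) ∧
    d0 ρ₀ ≤ dist (gam1 (Rof ρ₀) (d0 ρ₀) θ) (gam3 (Rof ρ₀) (d0 ρ₀) φ) ∧
    d0 ρ₀ ≤ dist (gam2 (Rof ρ₀) (d0 ρ₀) θ) (gam3 (Rof ρ₀) (d0 ρ₀) φ)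

/-- **Step 3.1 (i)′ — the proof sentence of (i) as printed** (p.12 l.49–52 «Minimizing over θ, ϕ … yields a
strictly positive lower bound when d₀ = αρ₀ with α ≥ 8 and R ≫ ρ₀»): for every `a ≥ 8` and `ρ₀ > 0`, for all
sufficiently large `R`, the distance between `γ₁` and `γ₂` (offset `d₀ = aρ₀`) is bounded below by a positive
constant. Same flag as `Step31_i`. [claim: Qin2026, status: under-review] [cite: Qin2026, Lemma 3.1 proof (i) p.12 l.49–52] -/
def Step31_i_asProved : Prop :=
  ∀ a ρ₀ : ℝ, 8 ≤ a → 0 < ρ₀ → ∃ R₁ : ℝ, ∀ R : ℝ, R₁ ≤ R → ∃ δ : ℝ, 0 < δ ∧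
    ∀ θ φ : ℝ, δ ≤ dist (gam1 R (a * ρ₀) θ) (gam2 R (a * ρ₀) φ)

/-- **Step 3.1 (ii) — «the Gauss linking integral equals exactly 4π²»** (p.12 l.46–48, l.53–59), typed as
printed for the pair (γ₁, γ₂) at the printed parameters: `∮∮ ⟨γ₁(θ) − γ₂(ϕ), γ̇₁(θ) × γ̇₂(ϕ)⟩/|γ₁(θ) −
γ₂(ϕ)|³ dϕ dθ = 4π²`. Recorded (for a genuine link the Gauss integral is `4π·lk`); not a composition input.
[claim: Qin2026, status: under-review] [cite: Qin2026, Lemma 3.1 (ii) p.12 l.46–59] -/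
def Step31_ii : Prop :=
  ∀ ρ₀ : ℝ, 0 < ρ₀ →
    (∫ θ in (0:ℝ)..(2 * Real.pi), ∫ φ in (0:ℝ)..(2 * Real.pi),
      inner ℝ (gam1 (Rof ρ₀) (d0 ρ₀) θ - gam2 (Rof ρ₀) (d0 ρ₀) φ)
          (cross (dgam1 (Rof ρ₀) θ) (dgam2 (Rof ρ₀) φ)) /
        ‖gam1 (Rof ρ₀) (d0 ρ₀) θ - gam2 (Rof ρ₀) (d0 ρ₀) φ‖ ^ 3) = 4 * Real.pi ^ 2

/-- A ROUND CIRCLE of radius `R` in `ℝ³` with its velocity: centre `c`, orthonormal frame `(e,f)`,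
`θ ↦ c + R cos θ e + R sin θ f`. [cite: Qin2026, Construction 3.1 p.12 l.26–31] -/
def IsRoundCircle (R : ℝ) (γ dγ : ℝ → E3) : Prop :=
  ∃ (c e f : E3), ‖e‖ = 1 ∧ ‖f‖ = 1 ∧ inner ℝ e f = 0 ∧
    (∀ θ, γ θ = c + (R * Real.cos θ) • e + (R * Real.sin θ) • f) ∧
    ∀ θ, dγ θ = (-(R * Real.sin θ)) • e + (R * Real.cos θ) • f

/-- The Gauss linking integral `(1/4π)∮∮ ⟨γ(θ) − γ′(ϕ), γ̇(θ) × γ̇′(ϕ)⟩/|γ(θ) − γ′(ϕ)|³ dϕ dθ` of two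
parametrised closed curves on `[0,2π]`. [cite: Qin2026, Lemma 3.1 (ii) p.12 l.46–48 («Gauss linking integral [4]»)] -/
def gaussLink (γ dγ γ' dγ' : ℝ → E3) : ℝ :=
  (1 / (4 * Real.pi)) * ∫ θ in (0:ℝ)..(2 * Real.pi), ∫ φ in (0:ℝ)..(2 * Real.pi),
    inner ℝ (γ θ - γ' φ) (cross (dγ θ) (dγ' φ)) / ‖γ θ - γ' φ‖ ^ 3

/-- **Step 3.1 — CHARITABLE face** (the author's words p.12 l.26–31 / Stage 1 p.31 l.51–53: «three suitably
chosen fibers … after an appropriate rotation … and a translational offset to guarantee a minimal separation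
d̄ = αρ₀», «Three pairwise-disjoint circular vortex centerlines … with linking number lk = +1 between any two
tubes»), with NO explicit formula: for every `ρ₀ > 0` there exist three round circles of radius `R = 10⁴ρ₀`
at pairwise distance `≥ 16ρ₀` with pairwise Gauss linking number `±1`. (REF-4 flag (a); TRUE in substance —
e.g. the v1 two-ring Hopf configuration extended; not discharged here.) [claim: Qin2026, status: under-review]
[cite: Qin2026, Construction 3.1 p.12 l.26–31; Thm 11.1 Stage 1 p.31 l.51–53] -/
def Step31_charitable : Prop :=
  ∀ ρ₀ : ℝ, 0 < ρ₀ → ∃ (γ dγ : Fin 3 → ℝ → E3), (∀ k, IsRoundCircle (Rof ρ₀) (γ k) (dγ k)) ∧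
    (∀ i j, i ≠ j → ∀ θ φ : ℝ, d0 ρ₀ ≤ dist (γ i θ) (γ j φ)) ∧
    ∀ i j, i ≠ j → |gaussLink (γ i) (dγ i) (γ j) (dγ j)| = 1

/-- **Step 3 — the datum is in the printed class** (Construction 3.2–3.4 + the data clause of Thm 1.1): for
`Γ₀, ρ₀ > 0`, `u0 Γ₀ ρ₀` is smooth, divergence-free, `L²`, `H¹`, with `|u₀| ≲ |x|⁻²` far field. TRUE-type in
substance (Biot–Savart field of compactly concentrated smooth vorticity); not discharged here.
[claim: Qin2026, status: under-review] [cite: Qin2026, §3 pp.12–14; Thm 1.1 p.8 l.21–31] -/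
def Step3_datum : Prop :=
  ∀ Γ₀ ρ₀ : ℝ, 0 < Γ₀ → 0 < ρ₀ → IsPrintedDatum (u0 Γ₀ ρ₀)

/-- **Step 5.8 — (41)–(42) p.21**: along every class solution from the datum, at every time of the blow-up
window («E(t) ≤ 2E₀», Step 2 / Thm 7.9), `S(t) ≥ (C_lower/(Γ₀L₀)) E(t)²` (`S` = the C119 `stretch` (33), `E` =
`Ens` (5)). An a-priori law for one flow. [claim: Qin2026, status: under-review] [cite: Qin2026, Thm 5.8 (41)–(42) p.21 l.6–23] -/
def Step58 : Prop :=
  ∀ (ν Γ₀ ρ₀ : ℝ), 0 < ν → 0 < Γ₀ → 0 < ρ₀ →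
    ∀ (T : ℝ) (u : ℝ → E3 → E3) (p : ℝ → E3 → ℝ), IsLocalSolution ν T (u0 Γ₀ ρ₀) u p →
      ∀ t ∈ Ico 0 T, (∀ s ∈ Icc 0 t, Ens u s ≤ 2 * E0 Γ₀ ρ₀) →
        Clower / (Γ₀ * L0 ρ₀) * Ens u t ^ 2 ≤ stretch u t

/-- **Step 5.8/2 — proof Step 2 p.21 at the real grain it is printed in**: «From (20), ρ₀² = C_E NΓ₀²L₀/E₀.
On the blowup window, E(t) ≤ 2E₀, hence ρ₀² ≥ C_E NΓ₀²L₀/(2E(t)). Substituting …: Γ₀³L₀²/ρ₀⁵ ≥ (Γ₀³L₀²/ρ₀) ·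
E(t)²/(C_E²N²Γ₀⁴L₀²)» — for positive reals with `ρ₀² = C_E NΓ₀²L₀/E₀` and `E ≤ 2E₀`. Typist's flag: SUSPICIOUS
(from a LOWER bound on `ρ₀²` one gets an UPPER bound on `1/ρ₀⁴`; the display fails whenever `E₀ < E ≤ 2E₀`).
[claim: Qin2026, status: under-review] [cite: Qin2026, Thm 5.8 proof Step 2 p.21 l.33–47] -/
def Step58_2 : Prop :=
  ∀ (cE N Γ₀ Lz ρ₀ Ez E : ℝ), 0 < cE → 0 < N → 0 < Γ₀ → 0 < Lz → 0 < ρ₀ → 0 < Ez → 0 < E →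
    ρ₀ ^ 2 = cE * N * Γ₀ ^ 2 * Lz / Ez → E ≤ 2 * Ez →
      (Γ₀ ^ 3 * Lz ^ 2 / ρ₀) * (E ^ 2 / (cE ^ 2 * N ^ 2 * Γ₀ ^ 4 * Lz ^ 2)) ≤ Γ₀ ^ 3 * Lz ^ 2 / ρ₀ ^ 5

/-- **Step 7.9 — Thm 7.9 (54) p.26 l.85 – p.27 l.6 at the real grain, with EXACTLY the inputs its proof
declares** («The proof uses only the definition (50) [ρ_η² := Γ(t)²L(t)/E_η(t)], the conservative bounds (51)
[Γ₀/2 ≤ Γ ≤ 2Γ₀, L₀/4 ≤ L ≤ 4L₀], and the window condition E_η ≤ 2E₀»; the proof identifies `Γ₀²L₀/E_η(0)`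
with `ρ₀²`): two-sided bound `ρ₀/C_ρ ≤ ρ_η ≤ C_ρρ₀`, `C_ρ = 4√2`, stated on squares. Typist's flag: the printed
UPPER bound line «Γ²L/E_η ≤ (2Γ₀)²(4L₀)/(E_η(0)/2)» uses `E_η(t) ≥ E_η(0)/2`, which is NOT among the declared
inputs (REF-4 flag (e): inputs typed as declared; the face WITH that input is `Step79_withLower`).
[claim: Qin2026, status: under-review] [cite: Qin2026, Thm 7.9 (54) p.26 l.85 – p.27 l.6] -/
def Step79 : Prop :=
  ∀ (Γ₀ Lz Eη0 Γ L Eη : ℝ), 0 < Γ₀ → 0 < Lz → 0 < Eη0 → 0 < Γ → 0 < L → 0 < Eη →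
    Γ₀ / 2 ≤ Γ → Γ ≤ 2 * Γ₀ → Lz / 4 ≤ L → L ≤ 4 * Lz → Eη ≤ 2 * Eη0 →
      (Γ₀ ^ 2 * Lz / Eη0) / 32 ≤ Γ ^ 2 * L / Eη ∧ Γ ^ 2 * L / Eη ≤ 32 * (Γ₀ ^ 2 * Lz / Eη0)

/-- **Step 7.9 — the face WITH the lower window bound `E_η(t) ≥ E_η(0)/2` that the printed upper-bound line
uses** (p.26 l.97–100). TRUE (real arithmetic); dischargeable. [claim: Qin2026, status: under-review]
[cite: Qin2026, Thm 7.9 proof p.26 l.97 – p.27 l.6] -/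
def Step79_withLower : Prop :=
  ∀ (Γ₀ Lz Eη0 Γ L Eη : ℝ), 0 < Γ₀ → 0 < Lz → 0 < Eη0 → 0 < Γ → 0 < L → 0 < Eη →
    Γ₀ / 2 ≤ Γ → Γ ≤ 2 * Γ₀ → Lz / 4 ≤ L → L ≤ 4 * Lz → Eη ≤ 2 * Eη0 → Eη0 / 2 ≤ Eη →
      (Γ₀ ^ 2 * Lz / Eη0) / 32 ≤ Γ ^ 2 * L / Eη ∧ Γ ^ 2 * L / Eη ≤ 32 * (Γ₀ ^ 2 * Lz / Eη0)

/-- **Step 8.2 — Cor 8.2 (58) p.28 at the ODE grain**: `y > 0` with `y′ ≥ C y²` on `[0,T)` satisfies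
`y(t) ≥ 1/(y(0)⁻¹ − Ct)` as long as `Ct < y(0)⁻¹`. TRUE (comparison); dischargeable.
[claim: Qin2026, status: under-review] [cite: Qin2026, Cor 8.2 (58) p.28 l.2–14] -/
def Step82_58 : Prop :=
  ∀ (C T : ℝ) (y D : ℝ → ℝ), 0 < C → 0 < T → (∀ t ∈ Ico 0 T, 0 < y t) →
    (∀ t ∈ Ico 0 T, HasDerivWithinAt y (D t) (Ici t) t ∧ C * y t ^ 2 ≤ D t) →
      ∀ t ∈ Ico 0 T, C * t < (y 0)⁻¹ → 1 / ((y 0)⁻¹ - C * t) ≤ y t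

/-- **Step 8.2′ — Cor 8.2 (59) + p.28 l.25–26 as USED, at the real-function grain**: (57) is available (Thm
8.1 via (41), (47), (53)) on the blow-up WINDOW `[0, T*_η]`, `T*_η := sup{T ≥ 0 : E_η(t) ≤ 2E_η(0) ∀t ≤ T}`
(Thm 7.9 p.26 l.87–90); the corollary concludes that `E_η` «blows up in finite time», `T* ≤ 1/(C_blow
E_η(0))`. Typed: for `y ≥ 0` continuous on `[0,∞)` with `y(0) > 0`, if `y′ ≥ C y²` holds at every `t ≥ 0`
with `∀ s ≤ t, y(s) ≤ 2y(0)`, then `y` is unbounded on `[0, 1/(C y(0)))`. Typist's flag: SUSPICIOUS (a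
function equal to `1/(y₀⁻¹ − Ct)` until it reaches `2y₀` and constant afterwards satisfies the hypothesis
and is bounded; on the window itself `y ≤ 2y(0)` by definition — LOCATORS §3 circularity map).
[claim: Qin2026, status: under-review] [cite: Qin2026, Cor 8.2 (59) p.28 l.15–26; Thm 7.9 p.26 l.87–90] -/
def Step82_59 : Prop :=
  ∀ (C : ℝ) (y D : ℝ → ℝ), 0 < C → ContinuousOn y (Ici 0) → 0 < y 0 → (∀ t, 0 ≤ t → 0 ≤ y t) →
    (∀ t, 0 ≤ t → (∀ s ∈ Icc 0 t, y s ≤ 2 * y 0) → HasDerivWithinAt y (D t) (Ici t) t ∧ C * y t ^ 2 ≤ D t) →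
      ¬ ∃ B : ℝ, ∀ t ∈ Ico 0 (1 / (C * y 0)), y t ≤ B

/-- **Step 8 — Thm 8.1 + Cor 8.2 AS USED with Thm 10.3's threshold** (p.28 l.25–26 «The weighted
enstrophy—and consequently the original enstrophy E(t) ≥ E_η(t)—blows up in finite time»; Def 3.7 / (65)
«Γ₀/ν > 2.27 × 10⁴»): for `Γ₀/ν > C_thr` there is `T* > 0` depending only on the datum such that along
every class solution from `u0 Γ₀ ρ₀` on `[0,T) ⊇ [0,T*)` the enstrophy is unbounded on `[0,T*)`. (C)-strength
for one datum; the printed route to it is `Step8_inference`. [claim: Qin2026, status: under-review]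
[cite: Qin2026, Thm 8.1 (57) p.27; Cor 8.2 (59) p.28 l.15–26; Thm 10.3 (65) p.30–31] -/
def Step8_out : Prop :=
  ∀ (ν Γ₀ ρ₀ : ℝ), 0 < ν → 0 < Γ₀ → 0 < ρ₀ → Cthr * ν < Γ₀ → ∃ Tstar : ℝ, 0 < Tstar ∧
    ∀ (T : ℝ) (u : ℝ → E3 → E3) (p : ℝ → E3 → ℝ), Tstar ≤ T → IsLocalSolution ν T (u0 Γ₀ ρ₀) u p →
      ¬ ∃ B : ℝ, ∀ t ∈ Ico 0 Tstar, Ens u t ≤ B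

/-- **Step 8″ — the printed inference §§3–8 to `Step8_out`**: Lemma 3.1 (i) (tube separation `d̄`, entering
(36)/(41) as `d̄⁻³` and §7.1), the stretching law (41), and Cor 8.2's window-to-blow-up passage give the
enstrophy blow-up; the untyped links ((36), (44), (47), (51), (53), (54), (55)) are recorded in the module
docstring. Typed as the implication. [claim: Qin2026, status: under-review] [cite: Qin2026, Thm 11.1 Proof Summary p.31 l.50 – p.32 l.25] -/
def Step8_inference : Prop :=
  Step31_i → Step58 → Step82_59 → Step8_out

/-- **Step 9.1 — Thm 9.1 (60) p.28–29 as used**: a class solution whose enstrophy is unbounded on `[0,T′)`,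
`T′ ≤ T`, has unbounded velocity gradient on `[0,T′)` (contrapositive of the `H¹` Grönwall bound
`E(t) ≤ E(0)exp(2∫₀ᵗ‖∇u‖_{L∞})` in the class). TRUE-type. [claim: Qin2026, status: under-review]
[cite: Qin2026, Thm 9.1 (60) p.28 l.29 – p.29 l.29] -/
def Step91 : Prop :=
  ∀ (ν T T' : ℝ) (v₀ : E3 → E3) (u : ℝ → E3 → E3) (p : ℝ → E3 → ℝ), 0 < ν → T' ≤ T →
    IsLocalSolution ν T v₀ u p → (∫⁻ x, ‖fderiv ℝ v₀ x‖ₑ ^ 2) < ⊤ →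
      (¬ ∃ B : ℝ, ∀ t ∈ Ico 0 T', Ens u t ≤ B) → GradBlowsUpAt T' u

/-! ## Compositions (pure logic; nothing asserted) -/

/-- **COMPOSITION — §3 datum + §8 enstrophy blow-up + §9 transfer reach Theorem 1.1**: for `ν > 0` take
`ρ₀ = 1`, `Γ₀ = (C_thr + 1)ν` (so `Γ₀/ν > C_thr`, Def 3.7); the datum is in the printed class (Step 3), §8
gives `T*` and the enstrophy blow-up along every class solution past `T*`, §9 turns it into gradient
blow-up. [cite: Qin2026, Thm 11.1 Proof Summary p.31–32] -/
theorem claim_of_steps (h3 : Step3_datum) (h8 : Step8_out) (h9 : Step91) : ClaimedTheorem := by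
  intro ν hν
  have hΓ : 0 < (Cthr + 1) * ν := by unfold Cthr; positivity
  have hthr : Cthr * ν < (Cthr + 1) * ν := by nlinarith
  obtain ⟨Tstar, hT0, hblow⟩ := h8 ν ((Cthr + 1) * ν) 1 hν hΓ one_pos hthr
  have hdat := h3 ((Cthr + 1) * ν) 1 hΓ one_pos
  refine ⟨u0 ((Cthr + 1) * ν) 1, hdat, Tstar, hT0, fun T u p hTT hsol => ?_⟩
  exact h9 ν T Tstar _ u p hν hTT hsol hdat.2.2.2.1 (hblow T u p hTT hsol)

/-- **COMPOSITION with the printed route to §8** — Lemma 3.1 (i) is ON PATH (binder `h31`).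
[cite: Qin2026, Thm 11.1 Proof Summary Stage 1 p.31 l.51–53] -/
theorem claim_of_steps_full (h31 : Step31_i) (h58 : Step58) (h59 : Step82_59) (hinf : Step8_inference)
    (h3 : Step3_datum) (h9 : Step91) : ClaimedTheorem :=
  claim_of_steps h3 (hinf h31 h58 h59) h9

/-- **Clay through the printed chain**: the steps, the Δ4 inference `Step112`, Clay (C).
[cite: FeffermanClay2006, (C) p.2] -/
theorem clayC_of_steps (h31 : Step31_i) (h58 : Step58) (h59 : Step82_59) (hinf : Step8_inference)
    (h3 : Step3_datum) (h9 : Step91) (h112 : Step112) : ClayVariants.clayR3.Breakdown :=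
  clayC_of_thm12 (h112 (claim_of_steps_full h31 h58 h59 hinf h3 h9))

/-! ## Rev 2 (append-only) — the continuous face of (58) and two discharges

`Step82_58` (l.407) omits the continuity of `y` on `[0,T)` that the print has (`y = E_η` is continuous); a
function that jumps DOWN from the left and keeps right derivatives satisfies its hypotheses and violates its
conclusion — a typing artefact, not the author's. The face to read is `Step82_58c` below (PROVED). -/

/-- **Step 8.2 (58) — CONTINUOUS face** (the print's `y = E_η` is continuous): as `Step82_58` with `y`
continuous on `[0,T)`. (`Step82_58` l.407 omits this hypothesis — a typing artefact: a function may jump down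
from the left and keep right derivatives; this is the face to read.) [claim: Qin2026, status: under-review]
[cite: Qin2026, Cor 8.2 (58) p.28 l.2–14] -/
def Step82_58c : Prop :=
  ∀ (C T : ℝ) (y D : ℝ → ℝ), 0 < C → 0 < T → ContinuousOn y (Ico 0 T) → (∀ t ∈ Ico 0 T, 0 < y t) →
    (∀ t ∈ Ico 0 T, HasDerivWithinAt y (D t) (Ici t) t ∧ C * y t ^ 2 ≤ D t) →
      ∀ t ∈ Ico 0 T, C * t < (y 0)⁻¹ → 1 / ((y 0)⁻¹ - C * t) ≤ y t

/-- **`Step82_58c` DISCHARGED** (Cor 8.2 (58) is correct calculus): `w = 1/y` has right derivative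
`−y′/y² ≤ −C`, so `w(t) ≤ w(0) − Ct` by the one-sided comparison principle
(`image_le_of_deriv_right_le_deriv_boundary`), and inverting gives (58). [cite: Qin2026, Cor 8.2 (58) p.28 l.2–14] -/
theorem step82_58c_holds : Step82_58c := by
  intro C T y D hC hT hcont hpos hder t ht hCt
  -- work on the closed slab `[0, t]`
  set w : ℝ → ℝ := fun s => (y s)⁻¹ with hw
  set B : ℝ → ℝ := fun s => (y 0)⁻¹ - C * s with hB
  have hsub : Icc (0:ℝ) t ⊆ Ico 0 T := fun s hs => ⟨hs.1, hs.2.trans_lt ht.2⟩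
  have hwcont : ContinuousOn w (Icc 0 t) := by
    refine ContinuousOn.inv₀ (hcont.mono hsub) fun s hs => (hpos s (hsub hs)).ne'
  have hwder : ∀ s ∈ Ico (0:ℝ) t, HasDerivWithinAt w (-(D s) / (y s) ^ 2) (Ici s) s := by
    intro s hs
    have hs' : s ∈ Ico 0 T := ⟨hs.1, hs.2.trans ht.2⟩
    exact (hder s hs').1.inv (hpos s hs').ne'
  have hBcont : ContinuousOn B (Icc 0 t) := by fun_prop
  have hBder : ∀ s ∈ Ico (0:ℝ) t, HasDerivWithinAt B (-C) (Ici s) s := by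
    intro s _
    have h1 : HasDerivAt (fun r : ℝ => (y 0)⁻¹ - C * r) (0 - C * 1) s :=
      (hasDerivAt_const s _).sub ((hasDerivAt_id s).const_mul C)
    simpa [hB] using h1.hasDerivWithinAt
  have hbound : ∀ s ∈ Ico (0:ℝ) t, -(D s) / (y s) ^ 2 ≤ -C := by
    intro s hs
    have hs' : s ∈ Ico 0 T := ⟨hs.1, hs.2.trans ht.2⟩
    have hy2 : 0 < (y s) ^ 2 := by have := hpos s hs'; positivity
    rw [div_le_iff₀ hy2, neg_mul, neg_le_neg_iff]
    exact (hder s hs').2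
  have hcmp := image_le_of_deriv_right_le_deriv_boundary hwcont hwder (by simp [hw, hB]) hBcont hBder hbound
    (right_mem_Icc.2 ht.1)
  -- `w t ≤ (y 0)⁻¹ − C t`, both sides positive: invert
  have hwt : 0 < w t := by simp only [hw]; exact inv_pos.2 (hpos t ht)
  have hBt : 0 < (y 0)⁻¹ - C * t := by linarith
  have : 1 / ((y 0)⁻¹ - C * t) ≤ 1 / w t := one_div_le_one_div_of_le hwt hcmp
  simpa [hw] using this

/-- **`Step79_withLower` DISCHARGED** (Thm 7.9's two displayed lines are correct arithmetic GIVEN the lower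
window bound `E_η ≥ E_η(0)/2`). [cite: Qin2026, Thm 7.9 proof p.26 l.97 – p.27 l.6] -/
theorem step79_withLower_holds : Step79_withLower := by
  intro Γ₀ Lz Eη0 Γ L Eη hΓ₀ hLz hE0 hΓ hL hEη hΓl hΓu hLl hLu hEu hEl
  constructor
  · -- lower: Γ²L/Eη ≥ (Γ₀/2)²(L₀/4)/(2Eη0) = Γ₀²L₀/(32Eη0)
    rw [le_div_iff₀ hEη]
    have h1 : Γ₀ ^ 2 / 4 ≤ Γ ^ 2 := by nlinarith
    have h2 : Γ₀ ^ 2 / 4 * (Lz / 4) ≤ Γ ^ 2 * L :=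
      mul_le_mul h1 hLl (by positivity) (by positivity)
    have h3 : Γ₀ ^ 2 * Lz / Eη0 / 32 * Eη ≤ Γ₀ ^ 2 * Lz / Eη0 / 32 * (2 * Eη0) :=
      mul_le_mul_of_nonneg_left hEu (by positivity)
    have h4 : Γ₀ ^ 2 * Lz / Eη0 / 32 * (2 * Eη0) = Γ₀ ^ 2 / 4 * (Lz / 4) := by
      field_simp; ring
    linarith
  · -- upper: Γ²L/Eη ≤ (2Γ₀)²(4L₀)/(Eη0/2) = 32Γ₀²L₀/Eη0
    rw [div_le_iff₀ hEη]
    have h1 : Γ ^ 2 ≤ 4 * Γ₀ ^ 2 := by nlinarith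
    have h2 : Γ ^ 2 * L ≤ 4 * Γ₀ ^ 2 * (4 * Lz) :=
      mul_le_mul h1 hLu hL.le (by positivity)
    have h3 : 32 * (Γ₀ ^ 2 * Lz / Eη0) * (Eη0 / 2) ≤ 32 * (Γ₀ ^ 2 * Lz / Eη0) * Eη :=
      mul_le_mul_of_nonneg_left hEl (by positivity)
    have h4 : 32 * (Γ₀ ^ 2 * Lz / Eη0) * (Eη0 / 2) = 4 * Γ₀ ^ 2 * (4 * Lz) := by
      field_simp; ring
    linarith

/-! ## Rev 3 (append-only below; line 2's import swapped `Mathlib.Analysis.Calculus.Gradient.Basic` →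
`Literature.Analysis.FluidPDE.VorticityEnstrophyGronwallForced`, which re-exports it) — Thm 9.1 discharged -/

/-- `E(t) = ½∫|ω|²` as a Bochner integral (the integrand is continuous, nonnegative). [cite: Qin2026, Thm 2.5 (5) p.10 l.34–36] -/
theorem ens_eq_integral {u : ℝ → E3 → E3} {t : ℝ} (hu : ContDiff ℝ 1 (u t)) :
    Ens u t = (1 / 2) * ∫ x, ‖curl (u t) x‖ ^ 2 := by
  unfold Ens enstrophy
  congr 1
  have hcont : Continuous fun x => curl (u t) x := by
    rw [curl_eq_curlCLM_comp]
    exact curlCLM.continuous.comp (hu.continuous_fderiv one_ne_zero)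
  rw [integral_eq_lintegral_of_nonneg_ae (Filter.Eventually.of_forall fun x => sq_nonneg _)
    ((hcont.norm.pow 2).aestronglyMeasurable)]
  congr 1
  refine lintegral_congr fun x => ?_
  rw [← ofReal_norm, ← ENNReal.ofReal_pow (norm_nonneg _)]

/-- **`Step91` DISCHARGED** (Thm 9.1 (60) in the BKM class): if the velocity gradient were bounded by `A` on
`[0,T′) × ℝ³`, then `‖ω‖_{L∞} ≤ ‖curl‖·A` there and the tree's `H¹` Grönwall form of Beale–Kato–Majda
(`sq_norm_curl_le_of_vorticity_sup_forced`, force `0`) bounds `E(t) ≤ E(0)·exp((2‖curl‖A + 1)T′)` on `[0,T′)`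
— so an unbounded enstrophy forces an unbounded gradient. [cite: Qin2026, Thm 9.1 (60) p.28 l.29 – p.29 l.29]
[cite: BealeKatoMajda1984, Thm 1] -/
theorem step91_holds : Step91 := by
  intro ν T T' v₀ u p hν hTT hsol _hv₀ hE hA
  -- `hA`: the gradient is bounded on `[0,T') × ℝ³`; bound the enstrophy there
  apply hE
  obtain ⟨A, hA⟩ := hA
  set κ : ℝ := ‖(curlCLM : (E3 →L[ℝ] E3) →L[ℝ] E3)‖ with hκ
  have hκ0 : 0 ≤ κ := norm_nonneg (curlCLM : (E3 →L[ℝ] E3) →L[ℝ] E3)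
  set A' : ℝ := max A 0 with hA'
  have hA'0 : 0 ≤ A' := le_max_right _ _
  set E0 : ℝ := ∫ x, ‖curl (u 0) x‖ ^ 2 with hE0
  have hE0nn : 0 ≤ E0 := integral_nonneg fun _ => sq_nonneg _
  set M : ℝ := (2 * (κ * A') + 1) * max T' 0 with hM
  refine ⟨(1 / 2) * (E0 * Real.exp M), fun t ht => ?_⟩
  have htT : t < T := lt_of_lt_of_le ht.2 hTT
  have hsm : ContDiff ℝ 1 (u t) := (hsol.isClassical.contDiff_velocity ⟨ht.1, htT⟩).of_le (by simp)
  rw [ens_eq_integral hsm]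
  refine mul_le_mul_of_nonneg_left ?_ (by norm_num)
  rcases ht.1.eq_or_lt with h0 | ht0
  · -- t = 0
    subst h0
    calc ∫ x, ‖curl (u 0) x‖ ^ 2 = E0 * 1 := by rw [hE0, mul_one]
      _ ≤ E0 * Real.exp M := mul_le_mul_of_nonneg_left (Real.one_le_exp (by positivity)) hE0nn
  · -- 0 < t < T': apply the H¹ Grönwall form on `[0, t]`
    have hU : UniqueDiffOn ℝ (Icc (0:ℝ) t) := uniqueDiffOn_Icc ht0
    have hS : IsClassicalNSSolutionOn (Icc 0 t) ν 0 u p :=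
      hsol.isClassical.mono (fun s hs => ⟨hs.1, lt_of_le_of_lt hs.2 htT⟩) hU
    have hB : HasBoundedSobolevNormsOn (Icc 0 t) u := hsol.sobolev t htT
    have hG : ∀ s ∈ Icc (0:ℝ) t, ∫⁻ x, ‖curl ((0 : ℝ → E3 → E3) s) x‖ₑ ^ 2 ≤ ((0 : ℝ≥0) : ℝ≥0∞) := by
      intro s _
      simp
    -- pointwise sup bound on `[0,t] ⊆ [0,T')`
    have hsup : ∀ s ∈ Ioo (0:ℝ) t, (⨆ x, ‖curl (u s) x‖ₑ) ≤ ENNReal.ofReal (κ * A') := by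
      intro s hs
      refine iSup_le fun x => ?_
      have hs' : s ∈ Ico 0 T' := ⟨hs.1.le, hs.2.trans ht.2⟩
      have h1 : ‖curl (u s) x‖ ≤ κ * A' :=
        (norm_curl_le (u s) x).trans (mul_le_mul_of_nonneg_left ((hA s hs' x).trans (le_max_left _ _)) hκ0)
      rw [← ofReal_norm]
      exact ENNReal.ofReal_le_ofReal h1
    have hint_le : (∫⁻ s in Ioo 0 t, ⨆ x, ‖curl (u s) x‖ₑ) ≤ ENNReal.ofReal (κ * A') * volume (Ioo (0:ℝ) t) := by
      calc (∫⁻ s in Ioo 0 t, ⨆ x, ‖curl (u s) x‖ₑ) ≤ ∫⁻ _ in Ioo (0:ℝ) t, ENNReal.ofReal (κ * A') :=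
            setLIntegral_mono measurable_const hsup
        _ = ENNReal.ofReal (κ * A') * volume (Ioo (0:ℝ) t) := setLIntegral_const _ _
    have hvol : volume (Ioo (0:ℝ) t) = ENNReal.ofReal t := by rw [Real.volume_Ioo, sub_zero]
    have hAfin : (∫⁻ s in Ioo 0 t, ⨆ x, ‖curl (u s) x‖ₑ) ≠ ⊤ := by
      refine ne_top_of_le_ne_top ?_ hint_le
      rw [hvol]; exact ENNReal.mul_ne_top ENNReal.ofReal_ne_top ENNReal.ofReal_ne_top
    have hmain := sq_norm_curl_le_of_vorticity_sup_forced hν ht0 hS hB hG hAfin t (right_mem_Icc.2 ht0.le)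
    -- simplify the bound
    have htoReal : (∫⁻ s in Ioo 0 t, ⨆ x, ‖curl (u s) x‖ₑ).toReal ≤ κ * A' * t := by
      have := ENNReal.toReal_mono (by rw [hvol]; exact ENNReal.mul_ne_top ENNReal.ofReal_ne_top ENNReal.ofReal_ne_top) hint_le
      rw [hvol, ENNReal.toReal_mul, ENNReal.toReal_ofReal (by positivity), ENNReal.toReal_ofReal ht0.le] at this
      exact this
    have hexp : Real.exp (2 * (∫⁻ s in Ioo 0 t, ⨆ x, ‖curl (u s) x‖ₑ).toReal + t) ≤ Real.exp M := by
      apply Real.exp_le_exp.2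
      have ht' : t ≤ max T' 0 := ht.2.le.trans (le_max_left _ _)
      have : 2 * (∫⁻ s in Ioo 0 t, ⨆ x, ‖curl (u s) x‖ₑ).toReal + t ≤ 2 * (κ * A' * t) + t := by linarith
      calc 2 * (∫⁻ s in Ioo 0 t, ⨆ x, ‖curl (u s) x‖ₑ).toReal + t ≤ 2 * (κ * A' * t) + t := this
        _ = (2 * (κ * A') + 1) * t := by ring
        _ ≤ (2 * (κ * A') + 1) * max T' 0 := mul_le_mul_of_nonneg_left ht' (by positivity)
    calc ∫ x, ‖curl (u t) x‖ ^ 2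
        ≤ (E0 + ((0:ℝ≥0) : ℝ) * t) * Real.exp (2 * (∫⁻ s in Ioo 0 t, ⨆ x, ‖curl (u s) x‖ₑ).toReal + t) := hmain
      _ = E0 * Real.exp (2 * (∫⁻ s in Ioo 0 t, ⨆ x, ‖curl (u s) x‖ₑ).toReal + t) := by simp [hE0]
      _ ≤ E0 * Real.exp M := mul_le_mul_of_nonneg_left hexp hE0nn

end Literature.Claims.NS.Qin2026

end

-- WHAT THIS IS NOT: not a claim about NS regularity or blow-up; not a claim about any author beyond the typed locator.
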